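/-
Copyright (c) 2026. All rights reserved.
Released under Apache 2.0 license as described in the file LICENSE.
Authors: HodgeCM publication cell (pub-hodgecm), GR lane, seat GR-1 (`pub-hodgecm-own-real34`).
-/
import Literature.NumberTheory.Automorphic.UnitaryGroupArchSiegelSquares
import Literature.NumberTheory.Automorphic.UnitaryGroupDoubledSiegelSquaresReps
import HarnessLib

/-!
# The Cayley–Levi homomorphism `GL_ι(E ⊗ ℝ) →* P_Δ(E ⊗ ℝ) ≤ U(J^𝔻)(E ⊗ ℝ)` of the doubled unitary group

Topic `NumberTheory/Automorphic`; namespace `Literature.NumberTheory.Automorphic` (sub-namespaces `DoubledUnitary`,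
`UnitaryGroup`).  KERNEL only: proved theorems (existentials over homomorphisms — no new definition), no named fact, no
`sorry`.  Companion of `UnitaryGroupDoubledSiegelSquaresReps` / `UnitaryGroupArchSiegelSquaresReps`, which write every
`p ∈ P_Δ` as `(∏ qᵢ²) · q` with `2 · q = C · diag(r, τ⁻¹ σ(r⁻¹)ᵀ τ) · C` for a representative `r` of `GL_ι` modulo squares:
here that `q` is exhibited as the value `m(r)` of a HOMOMORPHISM, so that a product decomposition of `r` (e.g. a sign
pattern as a product of one- and two-place sign elements) becomes one of `q`.

* §1 ring level: **`DoubledUnitary.exists_leviCayleyHom`** — for `σ` an involution of `R` with `2 ∈ Rˣ` and `S` symmetric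
  `σ`-fixed of unit determinant there is `m : GL_ι(R) →* GL_{ι⊕ι}(R)` with values in the Siegel parabolic `P_Δ` of
  `U(σ, S ⊕ −S)` (`m r ∈ U`, `(m r)₁₁ + (m r)₁₂ = (m r)₂₁ + (m r)₂₂`), `2 · m(r) = C · diag(r, τ⁻¹ σ(r⁻¹)ᵀ τ) · C`
  (`C = [[1,1],[1,−1]]`, `τ = S + S`), acting on `Δ` through `r`: `(m r)₁₁ + (m r)₁₂ = r`; and `eq_of_two_smul_eq` (such a
  `q` is unique);
* §2 archimedean points: **`UnitaryGroup.exists_leviCayleyHom_arch`** (and `…_of_base` for `J = (reindex e e (T ⊕ −T)) ⊗ 1`,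
  `T` over `F`) — `mA : GL_ι(E ⊗ ℝ) →* U(J)(E ⊗ ℝ)` with `archToAdelic (mA r) ∈ P_Δ(𝔸)` (`IsSiegelReindex`), the same matrix
  identity, and `deltaBlock = r`; **`UnitaryGroup.eq_of_two_smul_reindex_eq`** — an element of `U(J)(E ⊗ ℝ)` is determined by
  `2 · reindex e⁻¹ e⁻¹ (·)`, so the representative `q` of `exists_list_sq_mul_levi_of_isSiegel_archToAdelic` IS `mA r`.

([HarrisKudlaSweet1996, §1 (1.9)–(1.12)]: `P = MN`, `M ≅ GL(Δ)`; [Kudla1994, §3]; archimedean places of type (ii) of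
[GelbartRogawski1991, Prop. 3.1.1] — the Levi sign representatives on which the archimedean half is evaluated.)
Written for the stage-1 cell `pub-hodgecm` (seat GR-1); nothing here is a claim of the manuscripts adjudicated there.

## References

* M. Harris, S. S. Kudla, W. J. Sweet, J. Amer. Math. Soc. 9 (1996), §1 (1.9)–(1.12) [HarrisKudlaSweet1996].
* S. S. Kudla, Israel J. Math. 87 (1994), §3 [Kudla1994].
* A. Borel, H. Jacquet, PSPM 33.1 (1979), §4.1 [BorelJacquet1979].
-/

set_option autoImplicit false

noncomputable section

open NumberField NumberField.mixedEmbedding NumberField.InfinitePlace IsDedekindDomain Matrix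
open scoped MatrixGroups

namespace Literature.NumberTheory.Automorphic

/-! ## §1 Ring level -/

namespace DoubledUnitary

section Ring

variable {R : Type*} [CommRing R] {ι : Type*} [Fintype ι] [DecidableEq ι] (σ : R →+* R)

/-- **The Cayley–Levi homomorphism of the Siegel parabolic of `U(σ, S ⊕ −S)`, ring level.**  For `σ` an involution with
`2 ∈ Rˣ` and `S` symmetric, `σ`-fixed, of unit determinant there is a homomorphism `m : GL_ι(R) →* GL_{ι⊕ι}(R)` with
`m r ∈ P_Δ ≤ U(σ, S ⊕ −S)`, `2 · m r = C · diag(r, τ⁻¹ σ(r⁻¹)ᵀ τ) · C` (`C = [[1,1],[1,−1]]`, `τ = S + S`) and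
`(m r)₁₁ + (m r)₁₂ = r` (the action on the diagonal `Δ`). [cite: HarrisKudlaSweet1996, §1 (1.11)–(1.12)] -/
theorem exists_leviCayleyHom (hσ : ∀ x, σ (σ x) = x) (h2 : IsUnit (2 : R))
    {S : Matrix ι ι R} (hSσ : S.map σ = S) (hSs : Sᵀ = S) (hSu : IsUnit S.det) :
    ∃ m : GL ι R →* GL (ι ⊕ ι) R,
      (∀ r, m r ∈ unitaryGroupOfForm σ (Matrix.fromBlocks S 0 0 (-S))) ∧
      (∀ r, ((m r : GL (ι ⊕ ι) R) : Matrix (ι ⊕ ι) (ι ⊕ ι) R).toBlocks₁₁ + ((m r : GL (ι ⊕ ι) R) : Matrix (ι ⊕ ι) (ι ⊕ ι) R).toBlocks₁₂ =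
        ((m r : GL (ι ⊕ ι) R) : Matrix (ι ⊕ ι) (ι ⊕ ι) R).toBlocks₂₁ + ((m r : GL (ι ⊕ ι) R) : Matrix (ι ⊕ ι) (ι ⊕ ι) R).toBlocks₂₂) ∧
      (∀ r, (2 : R) • ((m r : GL (ι ⊕ ι) R) : Matrix (ι ⊕ ι) (ι ⊕ ι) R) =
        Matrix.fromBlocks (1 : Matrix ι ι R) (1 : Matrix ι ι R) (1 : Matrix ι ι R) (-1 : Matrix ι ι R) *
          Matrix.fromBlocks (r : Matrix ι ι R) 0 0 ((S + S)⁻¹ * (((r⁻¹ : GL ι R) : Matrix ι ι R).map σ)ᵀ * (S + S)) *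
          Matrix.fromBlocks (1 : Matrix ι ι R) (1 : Matrix ι ι R) (1 : Matrix ι ι R) (-1 : Matrix ι ι R)) ∧
      (∀ r, ((m r : GL (ι ⊕ ι) R) : Matrix (ι ⊕ ι) (ι ⊕ ι) R).toBlocks₁₁ + ((m r : GL (ι ⊕ ι) R) : Matrix (ι ⊕ ι) (ι ⊕ ι) R).toBlocks₁₂ =
        (r : Matrix ι ι R)) := by
  classical
  -- `u = 1/2`, fixed by `σ`
  obtain ⟨u, hu⟩ := h2.exists_left_inv
  have hu' : 2 * u = 1 := by rw [mul_comm]; exact hu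
  -- the Cayley unit
  set C : Matrix (ι ⊕ ι) (ι ⊕ ι) R :=
    Matrix.fromBlocks (1 : Matrix ι ι R) (1 : Matrix ι ι R) (1 : Matrix ι ι R) (-1 : Matrix ι ι R) with hC
  have hCC : C * C = (2 : R) • (1 : Matrix (ι ⊕ ι) (ι ⊕ ι) R) := cayleyMat_mul_self
  have hCu1 : C * (u • C) = 1 := by rw [Matrix.mul_smul, hCC, smul_smul, hu, one_smul]
  have hCu2 : u • C * C = 1 := by rw [Matrix.smul_mul, hCC, smul_smul, hu, one_smul]
  set Cu : GL (ι ⊕ ι) R := ⟨C, u • C, hCu1, hCu2⟩ with hCudef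
  -- `τ = 2S` and the antidiagonal form
  set τ : Matrix ι ι R := S + S with hτ
  have hτ2 : τ = (2 : R) • S := by rw [hτ, two_smul]
  have hτσ : τ.map σ = τ := by rw [hτ, Matrix.map_add (⇑σ) (map_add σ), hSσ]
  have hτs : τᵀ = τ := by rw [hτ, Matrix.transpose_add, hSs]
  have hτu : IsUnit τ.det := by
    rw [hτ2, Matrix.det_smul]
    exact (h2.pow _).mul hSu
  have hform : formCongr σ Cu (Matrix.fromBlocks S 0 0 (-S)) = Matrix.fromBlocks 0 τ τ 0 := formCongr_cayleyMat σ S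
  -- the Levi homomorphism in the Cayley model
  obtain ⟨m, hm, hmU⟩ := exists_leviHom σ hσ hτσ hτs hτu
  -- conjugate back by `C`
  refine ⟨(MulAut.conj Cu).toMonoidHom.comp m, fun r => ?_, fun r => ?_, fun r => ?_, fun r => ?_⟩
  · show Cu * m r * Cu⁻¹ ∈ _
    rw [conj_mem_unitaryGroupOfForm_iff σ Cu, hform]
    exact hmU r
  all_goals
    have hconj : (((MulAut.conj Cu).toMonoidHom.comp m r : GL (ι ⊕ ι) R) : Matrix (ι ⊕ ι) (ι ⊕ ι) R) =
        u • Matrix.fromBlocks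
          ((r : Matrix ι ι R) + 0 + (0 + τ⁻¹ * (((r⁻¹ : GL ι R) : Matrix ι ι R).map σ)ᵀ * τ))
          ((r : Matrix ι ι R) + 0 - (0 + τ⁻¹ * (((r⁻¹ : GL ι R) : Matrix ι ι R).map σ)ᵀ * τ))
          ((r : Matrix ι ι R) - 0 + (0 - τ⁻¹ * (((r⁻¹ : GL ι R) : Matrix ι ι R).map σ)ᵀ * τ))
          ((r : Matrix ι ι R) - 0 - (0 - τ⁻¹ * (((r⁻¹ : GL ι R) : Matrix ι ι R).map σ)ᵀ * τ)) := by
      change C * ((m r : GL (ι ⊕ ι) R) : Matrix (ι ⊕ ι) (ι ⊕ ι) R) * (u • C) = _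
      rw [Matrix.mul_smul, hm, hC, cayleyMat_mul_mul_cayleyMat]
  · rw [hconj, Matrix.fromBlocks_smul, Matrix.toBlocks_fromBlocks₁₁, Matrix.toBlocks_fromBlocks₁₂,
      Matrix.toBlocks_fromBlocks₂₁, Matrix.toBlocks_fromBlocks₂₂, ← smul_add, ← smul_add]
    congr 1
    abel
  · change (2 : R) • (C * ((m r : GL (ι ⊕ ι) R) : Matrix (ι ⊕ ι) (ι ⊕ ι) R) * (u • C)) = _
    rw [Matrix.mul_smul, smul_smul, hu', one_smul, hm]
  · rw [hconj, Matrix.fromBlocks_smul, Matrix.toBlocks_fromBlocks₁₁, Matrix.toBlocks_fromBlocks₁₂, ← smul_add]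
    have h : (r : Matrix ι ι R) + 0 + (0 + τ⁻¹ * (((r⁻¹ : GL ι R) : Matrix ι ι R).map σ)ᵀ * τ) +
        ((r : Matrix ι ι R) + 0 - (0 + τ⁻¹ * (((r⁻¹ : GL ι R) : Matrix ι ι R).map σ)ᵀ * τ)) = (2 : R) • (r : Matrix ι ι R) := by
      rw [two_smul]; abel
    rw [h, smul_smul, hu, one_smul]

/-- a matrix over `R` with `2 ∈ Rˣ` is determined by its double. [cite: HarrisKudlaSweet1996, §1 (1.11)] -/
theorem eq_of_two_smul_eq (h2 : IsUnit (2 : R)) {m : Type*} {X Y : Matrix m m R} (h : (2 : R) • X = (2 : R) • Y) : X = Y := by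
  obtain ⟨u, hu⟩ := h2.exists_left_inv
  have h' := congrArg (fun Z : Matrix m m R => u • Z) h
  simp only [smul_smul, hu, one_smul] at h'
  exact h'

end Ring

end DoubledUnitary

/-! ## §2 The archimedean points `U(J)(E ⊗ ℝ)` -/

namespace UnitaryGroup

section Arch

variable (F E : Type) [Field F] [NumberField F] [Field E] [NumberField E] [Algebra F E] (c : E ≃ₐ[F] E) (N : ℕ)
  (J : Matrix (Fin N) (Fin N) E) {ι : Type*} [Fintype ι] [DecidableEq ι] (e : ι ⊕ ι ≃ Fin N)

omit [NumberField F] [NumberField E] in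
/-- `(c ⊗ 1)² = 1` on `E ⊗ ℝ` for an involution `c`. [folklore] -/
private theorem conjMixed_conjMixed₃ (hc : ∀ x, c (c x) = x) (x : mixedSpace E) :
    conjMixed F E c (conjMixed F E c x) = x := by
  have hcc : c * c = 1 := AlgEquiv.ext fun y => by rw [AlgEquiv.mul_apply, hc]; rfl
  have hinv : c⁻¹ = c := inv_eq_of_mul_eq_one_right hcc
  have h := conjMixed_inv_apply F E c x
  rwa [hinv] at h

omit [NumberField F] [Field E] [NumberField E] [Algebra F E] [Fintype ι] [DecidableEq ι] in
/-- `reindex e.symm e.symm (reindex e e M) = M`. [folklore] -/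
private theorem reindex_symm_reindex₃ {R : Type*} (M : Matrix (ι ⊕ ι) (ι ⊕ ι) R) :
    Matrix.reindex e.symm e.symm (Matrix.reindex e e M) = M := by
  simp

omit [NumberField F] [NumberField E] in
/-- `2` is a unit of `E ⊗ ℝ`. [folklore] -/
private theorem isUnit_two_mixedSpace : IsUnit (2 : mixedSpace E) := by
  have : (2 : mixedSpace E) = algebraMap ℝ (mixedSpace E) 2 := by rw [map_ofNat]
  rw [this]
  exact (isUnit_iff_ne_zero.2 two_ne_zero).map _

omit [NumberField F] [NumberField E] [Fintype ι] [DecidableEq ι] in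
/-- **an element of `U(J)(E ⊗ ℝ)` is determined by `2 · reindex e⁻¹ e⁻¹` of its matrix** (`2 ∈ (E ⊗ ℝ)ˣ`).
[cite: HarrisKudlaSweet1996, §1 (1.11)] -/
theorem eq_of_two_smul_reindex_eq (q q' : arch F E c N J)
    (h : (2 : mixedSpace E) • Matrix.reindex e.symm e.symm
        (((q : arch F E c N J) : GL (Fin N) (mixedSpace E)) : Matrix (Fin N) (Fin N) (mixedSpace E)) =
      (2 : mixedSpace E) • Matrix.reindex e.symm e.symm
        (((q' : arch F E c N J) : GL (Fin N) (mixedSpace E)) : Matrix (Fin N) (Fin N) (mixedSpace E))) :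
    q = q' := by
  have h1 := DoubledUnitary.eq_of_two_smul_eq (isUnit_two_mixedSpace E) h
  have h2 : (((q : arch F E c N J) : GL (Fin N) (mixedSpace E)) : Matrix (Fin N) (Fin N) (mixedSpace E)) =
      (((q' : arch F E c N J) : GL (Fin N) (mixedSpace E)) : Matrix (Fin N) (Fin N) (mixedSpace E)) :=
    (Matrix.reindex e.symm e.symm).injective h1
  exact Subtype.ext (Units.ext h2)

/-- **The Cayley–Levi homomorphism `GL_ι(E ⊗ ℝ) →* U(J)(E ⊗ ℝ)` into the archimedean Siegel parabolic.**  Let `c` be an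
involution of `E/F`, `S₀ ∈ M_ι(E)` symmetric `c`-fixed of unit determinant, `J = reindex e e (S₀ ⊕ −S₀)` the doubled hermitian
form.  There is `mA : GL_ι(E ⊗ ℝ) →* U(J)(E ⊗ ℝ)` with `archToAdelic (mA r) ∈ P_Δ(𝔸)` (`DoubledUnitary.IsSiegelReindex e`),
`2 · reindex e⁻¹ e⁻¹ (mA r) = C · diag(r, τ⁻¹ (c ⊗ 1)(r⁻¹)ᵀ τ) · C` (`C = [[1,1],[1,−1]]`, `τ = S + S`, `S = S₀ ⊗ 1`) and
`(reindex e⁻¹ e⁻¹ (mA r))₁₁ + (reindex e⁻¹ e⁻¹ (mA r))₁₂ = r` (the action on `Δ ⊗ ℝ`).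
[cite: HarrisKudlaSweet1996, §1 (1.11)–(1.12)] [cite: BorelJacquet1979, §4.1] -/
theorem exists_leviCayleyHom_arch (hc : ∀ x, c (c x) = x)
    {S₀ : Matrix ι ι E} (hS₀c : S₀.map (c : E →+* E) = S₀) (hS₀s : S₀ᵀ = S₀) (hS₀u : IsUnit S₀.det)
    (hJ : J = Matrix.reindex e e (Matrix.fromBlocks S₀ 0 0 (-S₀))) :
    ∃ mA : GL ι (mixedSpace E) →* arch F E c N J,
      (∀ r, DoubledUnitary.IsSiegelReindex e
        ((archToAdelic F E c N J (mA r)).1 : GL (Fin N) (AdeleRing (𝓞 E) E))) ∧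
      (∀ r, (2 : mixedSpace E) • Matrix.reindex e.symm e.symm
          (((mA r : arch F E c N J) : GL (Fin N) (mixedSpace E)) : Matrix (Fin N) (Fin N) (mixedSpace E)) =
        Matrix.fromBlocks (1 : Matrix ι ι (mixedSpace E)) 1 1 (-1) *
          Matrix.fromBlocks (r : Matrix ι ι (mixedSpace E)) 0 0
            ((S₀.map (mixedEmbedding E) + S₀.map (mixedEmbedding E))⁻¹ *
              (((r⁻¹ : GL ι (mixedSpace E)) : Matrix ι ι (mixedSpace E)).map (conjMixed F E c))ᵀ *
              (S₀.map (mixedEmbedding E) + S₀.map (mixedEmbedding E))) *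
          Matrix.fromBlocks (1 : Matrix ι ι (mixedSpace E)) 1 1 (-1)) ∧
      (∀ r, (Matrix.reindex e.symm e.symm
            (((mA r : arch F E c N J) : GL (Fin N) (mixedSpace E)) : Matrix (Fin N) (Fin N) (mixedSpace E))).toBlocks₁₁ +
          (Matrix.reindex e.symm e.symm
            (((mA r : arch F E c N J) : GL (Fin N) (mixedSpace E)) : Matrix (Fin N) (Fin N) (mixedSpace E))).toBlocks₁₂ =
        (r : Matrix ι ι (mixedSpace E))) := by
  classical
  set S : Matrix ι ι (mixedSpace E) := S₀.map (mixedEmbedding E) with hS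
  have hσ : ∀ x, conjMixed F E c (conjMixed F E c x) = x := conjMixed_conjMixed₃ F E c hc
  have h2 : IsUnit (2 : mixedSpace E) := isUnit_two_mixedSpace E
  have hSσ : S.map (conjMixed F E c) = S := by
    rw [hS, Matrix.map_map]
    have : (⇑(conjMixed F E c) ∘ ⇑(mixedEmbedding E) : E → mixedSpace E) = ⇑(mixedEmbedding E) ∘ ⇑(c : E →+* E) :=
      funext fun x => conjMixed_mixedEmbedding F E c x
    rw [this, ← Matrix.map_map, hS₀c]
  have hSs : Sᵀ = S := by rw [hS, ← Matrix.transpose_map, hS₀s]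
  have hSu : IsUnit S.det := by
    rw [hS, ← RingHom.mapMatrix_apply, ← RingHom.map_det]
    exact hS₀u.map _
  have hJ' : archFormOf E N J = Matrix.reindex e e (Matrix.fromBlocks S 0 0 (-S)) := by
    rw [archFormOf, hJ, reindex_fromBlocks_neg_map, ← hS]
  -- the ring-level hom over `R = E ⊗ ℝ`, `σ = c ⊗ 1`
  obtain ⟨m, hmU, hmP, hm2, hmΔ⟩ := DoubledUnitary.exists_leviCayleyHom (conjMixed F E c) hσ h2 hSσ hSs hSu
  -- transport along `reindex e`
  set ψ : GL (ι ⊕ ι) (mixedSpace E) ≃* GL (Fin N) (mixedSpace E) :=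
    Units.mapEquiv (Matrix.reindexRingEquiv (mixedSpace E) e).toMulEquiv with hψ
  have hsub : (Matrix.reindex e e (Matrix.fromBlocks S 0 0 (-S))).submatrix e e = Matrix.fromBlocks S 0 0 (-S) := by
    rw [Matrix.reindex_apply, Matrix.submatrix_submatrix, Equiv.symm_comp_self, Matrix.submatrix_id_id]
  have hmem : ∀ g : GL (ι ⊕ ι) (mixedSpace E), g ∈ unitaryGroupOfForm (conjMixed F E c) (Matrix.fromBlocks S 0 0 (-S)) →
      ψ g ∈ arch F E c N J := by
    intro g hg
    have key := reindex_mem_unitaryGroupOfForm_iff (conjMixed F E c) e (Matrix.reindex e e (Matrix.fromBlocks S 0 0 (-S))) g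
    rw [hsub] at key
    show ψ g ∈ unitaryGroupOfForm (conjMixed F E c) (archFormOf E N J)
    rw [hJ']
    exact key.1 hg
  have hcoeψ : ∀ g : GL (ι ⊕ ι) (mixedSpace E),
      ((ψ g : GL (Fin N) (mixedSpace E)) : Matrix (Fin N) (Fin N) (mixedSpace E)) =
        Matrix.reindex e e (g : Matrix (ι ⊕ ι) (ι ⊕ ι) (mixedSpace E)) := fun g => rfl
  -- the hom into the subgroup `arch`
  let mA : GL ι (mixedSpace E) →* arch F E c N J :=
    { toFun := fun r => ⟨ψ (m r), hmem (m r) (hmU r)⟩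
      map_one' := Subtype.ext (by simp only [map_one]; rfl)
      map_mul' := fun r r' => Subtype.ext (by simp only [map_mul]; rfl) }
  have hmA : ∀ r, (((mA r : arch F E c N J) : GL (Fin N) (mixedSpace E)) : Matrix (Fin N) (Fin N) (mixedSpace E)) =
      Matrix.reindex e e ((m r : GL (ι ⊕ ι) (mixedSpace E)) : Matrix (ι ⊕ ι) (ι ⊕ ι) (mixedSpace E)) := fun r => rfl
  refine ⟨mA, fun r => ?_, fun r => ?_, fun r => ?_⟩
  · have h : DoubledUnitary.IsSiegelReindex e ((mA r : arch F E c N J) : GL (Fin N) (mixedSpace E)) := by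
      unfold DoubledUnitary.IsSiegelReindex
      rw [hmA, reindex_symm_reindex₃]
      exact hmP r
    exact (isSiegelReindex_ofInfinite_iff E N e ((mA r : arch F E c N J) : GL (Fin N) (mixedSpace E))).2 h
  · rw [hmA, reindex_symm_reindex₃]
    exact hm2 r
  · rw [hmA, reindex_symm_reindex₃]
    exact hmΔ r

/-- **The same, for a doubled form defined over the base field** (`J = (reindex e e (T ⊕ −T)) ⊗ 1`, `T ∈ M_ι(F)` symmetric
of unit determinant — the shape of GR-2's `hermD`). [cite: HarrisKudlaSweet1996, §1 (1.11)–(1.12)] -/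
theorem exists_leviCayleyHom_arch_of_base (hc : ∀ x, c (c x) = x)
    {T : Matrix ι ι F} (hTs : Tᵀ = T) (hTu : IsUnit T.det)
    (hJ : J = (Matrix.reindex e e (Matrix.fromBlocks T 0 0 (-T))).map (algebraMap F E)) :
    ∃ mA : GL ι (mixedSpace E) →* arch F E c N J,
      (∀ r, DoubledUnitary.IsSiegelReindex e
        ((archToAdelic F E c N J (mA r)).1 : GL (Fin N) (AdeleRing (𝓞 E) E))) ∧
      (∀ r, (2 : mixedSpace E) • Matrix.reindex e.symm e.symm
          (((mA r : arch F E c N J) : GL (Fin N) (mixedSpace E)) : Matrix (Fin N) (Fin N) (mixedSpace E)) =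
        Matrix.fromBlocks (1 : Matrix ι ι (mixedSpace E)) 1 1 (-1) *
          Matrix.fromBlocks (r : Matrix ι ι (mixedSpace E)) 0 0
            (((T.map (algebraMap F E)).map (mixedEmbedding E) + (T.map (algebraMap F E)).map (mixedEmbedding E))⁻¹ *
              (((r⁻¹ : GL ι (mixedSpace E)) : Matrix ι ι (mixedSpace E)).map (conjMixed F E c))ᵀ *
              ((T.map (algebraMap F E)).map (mixedEmbedding E) + (T.map (algebraMap F E)).map (mixedEmbedding E))) *
          Matrix.fromBlocks (1 : Matrix ι ι (mixedSpace E)) 1 1 (-1)) ∧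
      (∀ r, (Matrix.reindex e.symm e.symm
            (((mA r : arch F E c N J) : GL (Fin N) (mixedSpace E)) : Matrix (Fin N) (Fin N) (mixedSpace E))).toBlocks₁₁ +
          (Matrix.reindex e.symm e.symm
            (((mA r : arch F E c N J) : GL (Fin N) (mixedSpace E)) : Matrix (Fin N) (Fin N) (mixedSpace E))).toBlocks₁₂ =
        (r : Matrix ι ι (mixedSpace E))) := by
  refine exists_leviCayleyHom_arch F E c N J e hc (S₀ := T.map (algebraMap F E)) ?_ ?_ ?_ ?_
  · rw [Matrix.map_map]
    have : (⇑(c : E →+* E) ∘ ⇑(algebraMap F E) : F → E) = ⇑(algebraMap F E) := funext fun x => c.commutes x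
    rw [this]
  · rw [← Matrix.transpose_map, hTs]
  · rw [← RingHom.mapMatrix_apply, ← RingHom.map_det]
    exact hTu.map _
  · rw [hJ, reindex_fromBlocks_neg_map]

end Arch

end UnitaryGroup

end Literature.NumberTheory.Automorphic

end
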